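import Summits.ABC.IUTFork.Cor312FrameVolumePiecesM
import Summits.ABC.IUTFork.Cor312ThetaBoxesDH
import HarnessLib

/-!
# [IUTchIII] Corollary 3.12, statement — the `Cor312.Setting` over the M-LEVEL real log-shells `K_{v̲}` with the SHARP
# Dupuy–Hilado pilot regions read off Θ- and q-ideles of the genuine completions (G1-Θ unit P4 of `HOME/staging/w5/w5-d166/g4/G1-THETA-SHAPES.md`)

Record-only file (D-0012) of the abc-iut cell (seat abc-iut-w5-d166, gen 4; branch C «abc ⇐ S», C-lead ruling C-R12 (e)
«target #2′: the M-level (V̲, K_{v̲}) real volume setting»; sequel of units P1 `Cor312VolumesPadicSummandsM` (p433804) and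
P2′ `Cor312FrameVolumePiecesM`). TAKES NO SIDE on [IUTchIII] Cor. 3.12.

The F-LEVEL chain of record assembles the setting of the printed statement of [IUTchIII] Cor. 3.12 (kurims
`paper:url-4b091feeb646` p. 173 l. 41 – p. 174 l. 19) over pilot data `X : PilotData F` and the completions of `F`:
abc-iut-c312-3's sharp Dupuy–Hilado regions `ι_j(t_{Θ,j,v_j})·(R_I)^∼` from Θ-ideles (`sharpBoxDH`, `labelIdele`,
`Cor312PilotIdelesDH`; Dupuy–Hilado §3.7, §3.9, §4.10), the `q`-centre from `q`-ideles (`qCentreDH`), and abc-iut-c312-6/7's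
frames setting `settingOfFrameVolumes`/`Setting.ofFrames` (`Cor312VolumesRealFrames`, GENERIC over the situation). THIS
FILE is the M-LEVEL twin over abc-iut-c312-5's skeleton `Real.thetaIndexOfInitial D` and the genuine carriers `K_{v̲}`:

* §1 the Θ- AND q-IDELE BINDERS `t u i x`, `tq u x ∈ K_{v̲(x)}` (P1's `kOfM`, abc-iut-S7's rescaled completion of `K` at the
  section place — the type in which abc-iut-S2's GENUINE ideles `I.tΘ`, `I.tq` live, `ThetaVolumeInput`), the label idele
  `labelIdeleM` (`1` at label `0`), the sharp summand regions `sharpBoxM`, the Θ-boxes `thetaBoxM` (c312-3's generic `boxOf`;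
  everything at `∞`, the trivial archimedean container of the F-level files) and the `q`-centre `qCentreM` (c312-3's `centreOf`),
  `qCentreM_ne_zero`, `norm_qCentreM` (`‖ψ(ι_j(a))_i‖ = ‖a‖`);
* §2 the situation `situationMFrames` := abc-iut-c312-5's `Situation.ofShells` over `logShellsOfInitialDH D logvK` WITH the
  field-box volumes of P2′'s pieces (`realizes_situationMFrames`, by `rfl`), the finiteness of the `q`-support from «`q`-ideles
  are units off the rational places under `𝕍^bad_mod`» (`qSupport_finite_M`, via c312-6's generic
  `qSupport_finite_of_norm_eq_one`);
* §3 **`settingMSharp`** := c312-6's `settingOfFrameVolumes` over these data — a `Cor312.Setting` over an M-LEVEL situation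
  whose Θ-regions are `e⁻¹(Π_{v⃗} ι_j(t_{Θ,j,v̲_j})·(R_I)^∼)` (constant in the Kummer index `m`: Dupuy–Hilado §4.10's sharp
  (Ind3)), whose `q`-image is the hull-set of the `q`-centre, whose frames are the real frames of the genuine field
  factors and whose volumes are their Haar volumes; `settingMSharp_thetaRegion` (rfl), `settingMSharp_eq_settingOfFrameVolumes`
  (rfl) — so c312-6's `qLocal_ofFrames` / `thetaLocal_ofFrames_of_hull_eq` / `logvolMono_ofFrames` / `hul_nonempty_ofFrames`
  and abc-iut-c312-8's M-level provenance `Cor312Prov.isSettingOf_ofFrames` all read THIS setting.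

[cite: Mochizuki2012, IUTchI Def. 3.1 (e) p. 62] [cite: DupuyHilado2025, §3.7, §3.9, §4.10] [claim: Mochizuki2012, status: disputed]
for the quoted setting. HONEST FRAMING: the ideles are BINDERS here (unit P7 instantiates them at abc-iut-S2's `I.tΘ`/`I.tq`);
nothing here bears on the truth of [IUTchIII] Cor. 3.12 (`Cor312.Setting.Statement` untouched); typed ≠ proved; instantiated ≠
endorsed. Deliberately NOT here: `HullDefined`/`ThetaFinite`/`BridgeHyps` (unit P5), the Θ-side comparison (P6).
-/

noncomputable section

open Set Function NumberField IsDedekindDomain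
open scoped Pointwise

namespace Summit.ABC.IUTFork.Thm311.Real

open Cor312 Cor312Vol Literature.IUT.LogThetaLattice Literature.IUT.LogVolume Literature.IUT.HodgeTheaters
  Literature.NumberTheory.NumberFields

variable {F K Fbar : Type} [Field F] [NumberField F] [Field K] [NumberField K] [Algebra F K]
  [Field Fbar] [Algebra F Fbar] [Algebra K Fbar] {E : WeierstrassCurve F} [E.IsElliptic] {l : ℕ}
  {Pb : BadPlacePredicates K} (D : InitialThetaData F K Fbar E l Pb) {logvK : PadicLogsVal K}
  (hlog : LogvAnalyticVal logvK)

/-! ## §1. Idele binders in the genuine completions; sharp boxes; the `q`-centre -/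

section Ideles

variable
  (t : ∀ (u : FinitePlace ℚ) (_ : Fin (thetaIndexOfInitial D).lstar) (x : (thetaIndexOfInitial D).Fibre (Val.non u)),
    kOfM D (ratChar u) u (natCast_ratChar_mem u) x)
  (tq : ∀ (u : FinitePlace ℚ) (x : (thetaIndexOfInitial D).Fibre (Val.non u)),
    kOfM D (ratChar u) u (natCast_ratChar_mem u) x)

/-- The Θ-idele at the LABEL `j ∈ {0,…,l⋆}`: `t_{Θ,j,v̲}` for `j ≥ 1`, `1` at the label `0` (Dupuy–Hilado §3.9 "`𝒪_{v⃗}` in the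
other degrees"; twin of c312-3's `labelIdele`). [cite: DupuyHilado2025, §3.9] -/
def labelIdeleM (u : FinitePlace ℚ) (j : (thetaIndexOfInitial D).Label)
    (x : (thetaIndexOfInitial D).Fibre (Val.non u)) : kOfM D (ratChar u) u (natCast_ratChar_mem u) x :=
  if h : 0 < (j : ℕ) then
    t u ⟨(j : ℕ) - 1, by have hj : (j : ℕ) < (thetaIndexOfInitial D).lstar + 1 := j.2; omega⟩ x
  else 1

/-- At the label `j = i+1` the label idele is `t_{Θ,i+1,v̲}`. [cite: DupuyHilado2025, §3.9] -/
theorem labelIdeleM_labelSucc (u : FinitePlace ℚ) (i : Fin (thetaIndexOfInitial D).lstar)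
    (x : (thetaIndexOfInitial D).Fibre (Val.non u)) :
    labelIdeleM D t u (Setting.labelSucc i) x = t u i x := by
  unfold labelIdeleM
  have h0 : 0 < ((Setting.labelSucc i : (thetaIndexOfInitial D).Label) : ℕ) := by
    simp [Setting.labelSucc]
  rw [dif_pos h0]
  congr 1

/-- At the label `0` the label idele is `1`. [cite: DupuyHilado2025, §3.9] -/
theorem labelIdeleM_zero (u : FinitePlace ℚ) (x : (thetaIndexOfInitial D).Fibre (Val.non u)) :
    labelIdeleM D t u 0 x = 1 := by
  unfold labelIdeleM
  rw [dif_neg (by simp)]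

/-- The label idele is non-zero when the ideles are. [folklore] -/
theorem labelIdeleM_ne_zero (ht0 : ∀ u i x, t u i x ≠ 0) (u : FinitePlace ℚ) (j : (thetaIndexOfInitial D).Label)
    (x : (thetaIndexOfInitial D).Fibre (Val.non u)) : labelIdeleM D t u j x ≠ 0 := by
  unfold labelIdeleM
  split_ifs
  · exact ht0 _ _ _
  · exact one_ne_zero

/-- **The SHARP Dupuy–Hilado summand region** `ι_j(t_{Θ,j,v̲_j})·(R_I)^∼ ⊆ K_{v̲_0} ⊗_{ℚ_p} ⋯ ⊗_{ℚ_p} K_{v̲_j}` (the idele acts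
through the LAST tensor factor, Dupuy–Hilado §3.7/§3.9; the sharp (Ind3) reading §4.10; twin of c312-3's `sharpBoxDH`).
[cite: DupuyHilado2025, §3.7, §3.9, §4.10] -/
def sharpBoxM (u : FinitePlace ℚ) (j : (thetaIndexOfInitial D).Label)
    (e : (thetaIndexOfInitial D).Caps j → (thetaIndexOfInitial D).Fibre (Val.non u)) :
    Set ((presAtM D hlog u).X e) :=
  iota (ratChar u) ((presAtM D hlog u).kk e) (Fin.last _) (labelIdeleM D t u j (e (Fin.last _))) •
    (normalizedPacket (ratChar u) ((presAtM D hlog u).kk e) : Set ((presAtM D hlog u).X e))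

/-- The sharp region has positive finite Haar measure. [cite: DupuyHilado2025, §3.7] -/
theorem packetAdm_sharpBoxM (ht0 : ∀ u i x, t u i x ≠ 0) (u : FinitePlace ℚ) (j : (thetaIndexOfInitial D).Label)
    (e : (thetaIndexOfInitial D).Caps j → (thetaIndexOfInitial D).Fibre (Val.non u)) :
    PacketAdm (ratChar u) ((presAtM D hlog u).kk e) (sharpBoxM D hlog t u j e) :=
  packetAdm_iota_smul (ratChar u) _ (Fin.last _) (labelIdeleM_ne_zero D t ht0 u j _)
    (packetAdm_normalizedPacket (ratChar u) _)

/-- **The Θ-boxes of the M-level field-factor product** from the sharp summand regions (c312-3's generic `boxOf` at a finite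
place; everything at `∞` — the trivial archimedean container); constant in the Kummer index and in the abstract Θ-pilot
object (Dupuy–Hilado §4.10; twin of c312-3's `thetaBoxDH (sharpBoxDH t)`). [claim: Mochizuki2012, status: disputed] -/
def thetaBoxM : ∀ (j : (thetaIndexOfInitial D).Label) (vQ : (thetaIndexOfInitial D).VQ),
    Set (∀ s : factorIdxM D hlog j vQ, factorFieldM D hlog j vQ s)
  | _, .inl _ => Set.univ
  | j, .inr u => (presAtM D hlog u).boxOf (sharpBoxM D hlog t u j)

/-- **The `q`-centre** `λ_q` of the M-level field-factor product read off the `q`-ideles: `λ_{q,(v⃗,i)} = ψ_{v⃗}(ι_j(t_{q,v̲_j}))_i`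
at a finite place (c312-3's generic `centreOf`), the empty tuple at `∞` (twin of c312-3's `qCentreDH`). [cite: DupuyHilado2025, §3.9] -/
def qCentreM : ∀ (j : (thetaIndexOfInitial D).Label) (vQ : (thetaIndexOfInitial D).VQ),
    ∀ s : factorIdxM D hlog j vQ, factorFieldM D hlog j vQ s
  | _, .inl _ => fun s => s.elim
  | _, .inr u => (presAtM D hlog u).centreOf fun e =>
      iota (ratChar u) ((presAtM D hlog u).kk e) (Fin.last _) (tq u (e (Fin.last _)))

/-- **`hq` PROVED**: every component of the `q`-centre is non-zero (`‖ψ(ι_j(a))_i‖ = ‖a‖`). [cite: Mochizuki2012, IUTchIV Prop. 1.4 (i) p. 13] -/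
theorem qCentreM_ne_zero (htq0 : ∀ u x, tq u x ≠ 0) :
    ∀ (j : (thetaIndexOfInitial D).Label) (vQ : (thetaIndexOfInitial D).VQ) (s : factorIdxM D hlog j vQ),
      qCentreM D hlog tq j vQ s ≠ 0
  | _, .inl _, s => s.elim
  | _, .inr u, ⟨e, i⟩ => dEquiv_iota_ne_zero (ratChar u) ((presAtM D hlog u).kk e) (Fin.last _) (htq0 u _) i

/-- The norms of the `q`-centre's components at a finite place are the norms of the `q`-ideles at the last slot.
[cite: Mochizuki2012, IUTchIV Prop. 1.4 (i) p. 13] -/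
theorem norm_qCentreM (j : (thetaIndexOfInitial D).Label) (u : FinitePlace ℚ)
    (s : factorIdxM D hlog j (Val.non u)) :
    ‖qCentreM D hlog tq j (Val.non u) s‖ = ‖tq u (s.1 (Fin.last _))‖ :=
  norm_dEquiv_iota (ratChar u) ((presAtM D hlog u).kk s.1) (Fin.last _) _ s.2

end Ideles

/-! ## §2. The M-level situation with the field-box volumes; finiteness of the `q`-support -/

section Situation

variable (M : Type) [Field M] [NumberField M]
  (archPk : ∀ (j : (thetaIndexOfInitial D).Label) (vQ : (thetaIndexOfInitial D).VQ),
    Set ((logShellsOfInitialDH D logvK).Packet j vQ))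
  (archSub : ∀ (j : (thetaIndexOfInitial D).Label) (v : (thetaIndexOfInitial D).V),
    Set ((logShellsOfInitialDH D logvK).Packet j ((thetaIndexOfInitial D).over v)))
  (Ψ : ℤ → ∀ v : (thetaIndexOfInitial D).V, v ∈ (thetaIndexOfInitial D).Vbad →
    Set ((logShellsOfInitialDH D logvK).StarPacket v))
  (act : ℤ → ∀ v : (thetaIndexOfInitial D).V, v ∈ (thetaIndexOfInitial D).Vbad →
    (logShellsOfInitialDH D logvK).StarPacket v → Module.End ℚ ((logShellsOfInitialDH D logvK).StarPacket v))
  (Mmod : ℤ → ∀ j : (thetaIndexOfInitial D).LabelStar, Set ((logShellsOfInitialDH D logvK).GlobalPacket j.1))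
  (region : ℤ → ∀ j : (thetaIndexOfInitial D).LabelStar, FinDivisor M → ∀ vQ : (thetaIndexOfInitial D).VQ,
    Set ((logShellsOfInitialDH D logvK).Packet j.1 vQ))
  (n : ℤ)

/-- **The situation of Thm. 3.11 over the M-level real log-shells WITH THE FIELD-BOX VOLUMES** of P2′'s pieces (abc-iut-c312-5's
`Situation.ofShells`; the other binders = the context data of the line). [claim: Mochizuki2012, status: disputed] -/
abbrev situationMFrames : Situation (thetaIndexOfInitial D) :=
  Situation.ofShells (logShellsOfInitialDH D logvK) M archPk archSub (frameVolumePiecesOfInitialDH D hlog).Adm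
    (frameVolumePiecesOfInitialDH D hlog).logvol Ψ act Mmod region

/-- Every line of `situationMFrames` CARRIES the pieces' volumes (by `rfl`). [folklore] -/
theorem realizes_situationMFrames :
    (frameVolumePiecesOfInitialDH D hlog).Realizes ((situationMFrames D hlog M archPk archSub Ψ act Mmod region).D n) :=
  ⟨fun _ _ _ => Iff.rfl, fun _ _ _ => rfl⟩

variable {HT : Type} {LogLink : HT → HT → Type} {IsFull : ∀ {s t : HT}, LogLink s t → Prop}
  (lat : LGPGaussianLogThetaLattice LogLink IsFull)
  {Frd : Type} {IsoF : Frd → Frd → Type} {Ob : Frd → Type} {realify : Frd → Frd} {Strip : Type}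
  {IsoS : Strip → Strip → Type} {Mv : ∀ v : (thetaIndexOfInitial D).V, v ∈ (thetaIndexOfInitial D).Vbad → Type}
  [∀ v h, Monoid (Mv v h)]
  (sig : GlobalLGPFrobenioidSignature (thetaIndexOfInitial D).lstar (thetaIndexOfInitial D).V
    (· ∈ (thetaIndexOfInitial D).Vbad) Frd IsoF Ob realify Strip IsoS Mv)
  (split : SplittingMonoids Mv) {ObΔ : Type} {N : ∀ v : (thetaIndexOfInitial D).V, v ∈ (thetaIndexOfInitial D).Vbad → Type}
  [∀ v h, Monoid (N v h)] (qData : QPilotData ObΔ N)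
  (t : ∀ (u : FinitePlace ℚ) (_ : Fin (thetaIndexOfInitial D).lstar) (x : (thetaIndexOfInitial D).Fibre (Val.non u)),
    kOfM D (ratChar u) u (natCast_ratChar_mem u) x)
  (tq : ∀ (u : FinitePlace ℚ) (x : (thetaIndexOfInitial D).Fibre (Val.non u)),
    kOfM D (ratChar u) u (natCast_ratChar_mem u) x)
  (htq0 : ∀ u x, tq u x ≠ 0)
  /- the `q`-ideles are units off a finite set of rational places (e.g. those under `𝕍^bad_mod`) -/
  (Sq : Finset (FinitePlace ℚ))
  (htq1 : ∀ (u : FinitePlace ℚ) (x : (thetaIndexOfInitial D).Fibre (Val.non u)), u ∉ Sq → ‖tq u x‖ = 1)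

include htq1 in
/-- **The `q`-support is finite** ([IUTchIII] Prop. 3.9 (iii)): off the finite set `Sq` of rational places every component of the
`q`-centre has norm `1`, so the local `q`-volume vanishes there (c312-6 `qSupport_finite_of_norm_eq_one`); at `∞` there is no
component. [cite: Mochizuki2012, IUTchIII Prop. 3.9 (iii) p. 117] -/
theorem qSupport_finite_M (j : (thetaIndexOfInitial D).Label) :
    (Function.support fun vQ => ((situationMFrames D hlog M archPk archSub Ψ act Mmod region).D n).logvol j vQ
      ((frameVolumePiecesOfInitialDH D hlog).e j vQ ⁻¹'
        hullSet ((frameVolumePiecesOfInitialDH D hlog).K j vQ)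
          ((fun _ : ObΔ => qCentreM D hlog tq) (qPilotObject qData) j vQ))).Finite := by
  refine FrameVolumePieces.qSupport_finite_of_norm_eq_one (S := situationMFrames D hlog M archPk archSub Ψ act Mmod region)
    (V := frameVolumePiecesOfInitialDH D hlog) (qData := qData) (qCentre := fun _ => qCentreM D hlog tq)
    (realizes_situationMFrames D hlog M archPk archSub Ψ act Mmod region n) j ?_
  refine ((Sq.finite_toSet.image Val.non)).subset ?_
  rintro vQ ⟨s, hs⟩
  rcases vQ with w | u
  · exact s.elim
  · refine ⟨u, ?_, rfl⟩
    by_contra hu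
    exact hs ((norm_qCentreM D hlog tq j u s).trans (htq1 u _ hu))

/-! ## §3. The setting -/

/-- **The setting of [IUTchIII] Cor. 3.12 over the M-LEVEL real log-shells `K_{v̲}` with the SHARP Dupuy–Hilado regions read off
ideles** — abc-iut-c312-6's `settingOfFrameVolumes` (= abc-iut-c312-7's `Setting.ofFrames`, `hadm` discharged) over P2′'s field-box
pieces, Θ-boxes `thetaBoxM t` (constant in the Kummer index and in the abstract Θ-pilot object: Dupuy–Hilado §4.10),
`q`-centre `qCentreM tq` (`hq` from `htq0`), `hfin` from `htq1`; REMAINING binders: the column `n`, the context data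
`lat`/`sig`/`split`/`qData` and the situation's `M archPk archSub Ψ act Mmod region` (free by design, as at the F level), and the
ideles `t`, `tq`. [claim: Mochizuki2012, status: disputed] -/
def settingMSharp : Cor312.Setting (situationMFrames D hlog M archPk archSub Ψ act Mmod region) :=
  FrameVolumePieces.settingOfFrameVolumes (S := situationMFrames D hlog M archPk archSub Ψ act Mmod region)
    (V := frameVolumePiecesOfInitialDH D hlog) (n := n) lat sig split qData (fun _ _ => thetaBoxM D hlog t)
    (fun _ => qCentreM D hlog tq) (fun j vQ s => qCentreM_ne_zero D hlog tq htq0 j vQ s)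
    (qSupport_finite_M D hlog M archPk archSub Ψ act Mmod region n qData tq Sq htq1)
    (realizes_situationMFrames D hlog M archPk archSub Ψ act Mmod region n)

/-- Same column. [folklore] -/
theorem settingMSharp_n :
    (settingMSharp D hlog M archPk archSub Ψ act Mmod region n lat sig split qData t tq htq0 Sq htq1).n = n := rfl

/-- **Every `(n,m)`-Kummer image of the Θ-pilot object IS the preimage of the (constant-in-`m`) sharp Θ-box** (Dupuy–Hilado §4.10;
twin of abc-iut-c312-7's `thetaRegion_sharp_Pr`). [cite: DupuyHilado2025, §4.10] -/
theorem settingMSharp_thetaRegion (m : ℤ) (j : (thetaIndexOfInitial D).Label) (vQ : (thetaIndexOfInitial D).VQ) :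
    (settingMSharp D hlog M archPk archSub Ψ act Mmod region n lat sig split qData t tq htq0 Sq htq1).thetaRegion m j vQ =
      factorMapM D hlog j vQ ⁻¹' thetaBoxM D hlog t j vQ :=
  rfl

/-- The `q`-image is the preimage of the hull-set of the `q`-centre. [cite: DupuyHilado2025, §3.9] -/
theorem settingMSharp_qRegion (j : (thetaIndexOfInitial D).Label) (vQ : (thetaIndexOfInitial D).VQ) :
    (settingMSharp D hlog M archPk archSub Ψ act Mmod region n lat sig split qData t tq htq0 Sq htq1).qRegion j vQ =
      factorMapM D hlog j vQ ⁻¹' hullSet (factorFieldM D hlog j vQ) (qCentreM D hlog tq j vQ) :=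
  rfl

/-- At a finite place the (Ind3)-enlarged Θ-region is the preimage of c312-3's box of the sharp summand regions
`Π_{v⃗} ι_j(t_{Θ,j,v̲_j})·(R_I)^∼` (the union over `m` of a constant family). [cite: DupuyHilado2025, §4.10] -/
theorem settingMSharp_thetaRegion3_non (j : (thetaIndexOfInitial D).Label) (u : FinitePlace ℚ) :
    (settingMSharp D hlog M archPk archSub Ψ act Mmod region n lat sig split qData t tq htq0 Sq htq1).thetaRegion3 j
        (Val.non u) =
      (fun x => (presAtM D hlog u).factorMap j x) ⁻¹' (presAtM D hlog u).boxOf (sharpBoxM D hlog t u j) := by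
  ext x
  rw [Setting.thetaRegion3, Set.mem_iUnion]
  exact ⟨fun ⟨_, h⟩ => h, fun h => ⟨0, h⟩⟩

/-- **The local `q`-volume in CLOSED FORM** (c312-6 `qLocal_ofFrames`): `qLocal j v_ℚ = Σ_s W_s·μ̇^log_s(λ_{q,s})`.
[claim: Mochizuki2012, status: disputed] -/
theorem qLocal_settingMSharp (j : (thetaIndexOfInitial D).Label) (vQ : (thetaIndexOfInitial D).VQ) :
    (settingMSharp D hlog M archPk archSub Ψ act Mmod region n lat sig split qData t tq htq0 Sq htq1).qLocal j vQ =
      ∑ s, (frameVolumePiecesOfInitialDH D hlog).w j vQ s *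
        ((frameVolumePiecesOfInitialDH D hlog).vol j vQ s).mulLogvol (qCentreM D hlog tq j vQ s) :=
  FrameVolumePieces.qLocal_ofFrames (S := situationMFrames D hlog M archPk archSub Ψ act Mmod region)
    (V := frameVolumePiecesOfInitialDH D hlog) lat sig split qData (fun _ _ => thetaBoxM D hlog t)
    (fun _ => qCentreM D hlog tq) (fun j vQ s => qCentreM_ne_zero D hlog tq htq0 j vQ s)
    (FrameVolumePieces.hadm_of_realizes (S := situationMFrames D hlog M archPk archSub Ψ act Mmod region)
      (V := frameVolumePiecesOfInitialDH D hlog) (realizes_situationMFrames D hlog M archPk archSub Ψ act Mmod region n))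
    (qSupport_finite_M D hlog M archPk archSub Ψ act Mmod region n qData tq Sq htq1) (realizes_situationMFrames D hlog M archPk archSub Ψ act Mmod region n) j vQ

/-- **`BridgeHyps.mono` holds** for the M-level sharp setting (c312-6 `logvolMono_ofFrames`). [folklore] -/
theorem logvolMono_settingMSharp :
    LogvolMono (settingMSharp D hlog M archPk archSub Ψ act Mmod region n lat sig split qData t tq htq0 Sq htq1) :=
  FrameVolumePieces.logvolMono_ofFrames (S := situationMFrames D hlog M archPk archSub Ψ act Mmod region)
    (V := frameVolumePiecesOfInitialDH D hlog) lat sig split qData (fun _ _ => thetaBoxM D hlog t)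
    (fun _ => qCentreM D hlog tq) (fun j vQ s => qCentreM_ne_zero D hlog tq htq0 j vQ s)
    (FrameVolumePieces.hadm_of_realizes (S := situationMFrames D hlog M archPk archSub Ψ act Mmod region)
      (V := frameVolumePiecesOfInitialDH D hlog) (realizes_situationMFrames D hlog M archPk archSub Ψ act Mmod region n))
    (qSupport_finite_M D hlog M archPk archSub Ψ act Mmod region n qData tq Sq htq1) (realizes_situationMFrames D hlog M archPk archSub Ψ act Mmod region n)

end Situation

end Summit.ABC.IUTFork.Thm311.Real

end
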